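import Summits.QuantumFields.YangMills.Theorems.MirrorModularBoostsSoftKernelBoostCovarianceBumpChainLink
import Summits.QuantumFields.YangMills.Theorems.MirrorModularBoostsSoftKernelBoostCovarianceAsmConstantsAndBumps

/-!
# The operator chain of a radial-bump tensor — stub (T3, part B)

Line `Sketch` of crux `MirrorModularBoosts.SoftKernelBoostCovariance` (stmt-QuantumFields-14999).  Model-blind
Osterwalder–Schrader bookkeeping over the `e₀`-reconstruction `h : OSReconstructionNoE1 S₁.toLabelled` of a
one-species Schwinger family `S₁` on `ℝ⁴`; the iteration of the landed ONE LINK `stub_bumpChainLink` (part A,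
`…BumpChainLink.lean`) along a RADIAL-BUMP TENSOR
`T x = ∏ j φ(|planar x_j − c j|²) · hh j (transverse x_j)` (common radial profile `φ` vanishing beyond `ρ²`,
planar centres `c j`, transverse profiles `hh j`).

**Statement** (`stub_bumpChain`).  Data: a cone family `N` (`‖N‖ ≤ 1` and weakly holomorphic on the planar tube
`{|Im b| < Re t}`, `N(t,b) = e^{-tH}U(b e₁)` at real `t > 0`), the items `f j` (the bump centred at the planar point
`(u+ρ, 0)` times `hh j`), insertion operators `B j Ψ_W = Ψ_{f j ⊗ W_{(2u+v)e₀}}` on degree-`(n-1-j)` field vectors,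
previous points `p j` (`q` for `j = 0`, `c (j-1)` after) and reserves `r j` (`w+u+ρ` for `j = 0`, `2u+v` after) such
that every consecutive complex-rotated gap `R_ζ(c j − p j) − r j e₀` stays in the tube on the rectangle
`{|Re ζ| < ε, |Im ζ| < R}`, `R > 0`.  Conclusion: (1) for real `|θ| < ε` the rotated configuration seen from `R_θ q`
and pulled back by `w e₀`, `τ_{−(R_θ q + w e₀)} R_θ T`, is time-ordered; (2) there is `V : ℂ → ℋ` holomorphic on the
rectangle, bounded by `(∏ j ‖B j‖) · ‖Ψ_1‖`, whose real values are the field vectors of these configurations.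

**Proof.**
* `cfg_apply_bc`: by `rot_bump_apply` (a rotation moves the centres of a radial-bump tensor and nothing else) the
  configuration is pointwise `∏ j φ((x_j⁰ + (R_θ q)₀ + w − (R_θ c_j)₀)² + (x_j¹ + (R_θ q)₁ − (R_θ c_j)₁)²) hh j (…)`.
* `isTimeOrdered_cfg_bc` — conclusion (1), directly for every degree: on the support every factor is non-zero,
  so slot `j` has time within `ρ` of `(R_θ c_j)₀ − (R_θ q)₀ − w` (closedness passes this to the topological
  support); at real angles the tube hypothesis (`gap_pos_of_tube`) says `(R_θ(c₀ − q))₀ > w + u + ρ` and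
  `(R_θ(c_{i+1} − c_i))₀ > 2u + v`, whence the first time exceeds `u > 0` and consecutive times increase by more
  than `2u + v − 2ρ > 0` (`Fin.strictMono_iff_lt_succ`).
* `chain_exists_bc` — conclusion (2), by induction on the degree with the insertion hypothesis stated for a general
  degree `m = n − 1 − j` (so that it restricts to the tail without casts).  Degree `0`: `T ≡ 1` (empty product), the
  configuration IS the empty test function (`fieldVec_congr_cast`), `V ≡ Ψ_1`.  Degree `n + 1`: the tail tensor
  `T'` (centres `c ∘ succ`, profiles `hh ∘ succ`) exists as a Schwartz map (`exists_bumpTensor_asm`, items recentred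
  by `translateMulti`); the induction hypothesis seen from `q' = c 0` with pull-back `w' = u + v − ρ ≥ 0` (its first
  reserve `w' + u + ρ = 2u + v`) gives the tail family `V'`; (1) for the tail gives its time-ordering; the landed link
  `stub_bumpChainLink` with `M = (∏ i ‖B i.succ‖) ‖Ψ_1‖` gives `V ζ = N(R_ζ(c₀ − q) − (w+u+ρ)e₀) B₀ V'(ζ)`, holomorphic,
  bounded by `‖B 0‖ M = (∏ j ‖B j‖) ‖Ψ_1‖` (`Fin.prod_univ_succ`), with the right real values because the whole
  configuration is pointwise (rotated item `0`) × (tail configuration of `Fin.tail x`) (`cfg_apply_bc` twice and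
  `Fin.prod_univ_succ`).
* `stub_bumpChain`: substitute `p`, `r` into the tube hypothesis and combine.

References: J. Glimm, A. Jaffe, *Quantum Physics* (2nd ed. 1987), §19.5–19.7; K. Osterwalder, R. Schrader, CMP 31
(1973) §4.1 (4.5)–(4.6); CMP 42 (1975) §V (the analytic continuation in the rotation angle).
-/

noncomputable section

namespace Summit.QuantumFields.YangMills.Theorems.SoftKernelBoostCovariance.Sketch

open scoped BigOperators InnerProductSpace SchwartzMap
open Literature.MathematicalPhysics.QuantumLattice Literature.MathematicalPhysics.AQFT
  Literature.MathematicalPhysics.QuantumFieldTheory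
open Summit.QuantumFields.YangMills.Theorems.NPointIsotropy.Negative (E4)

/-! ## The rotated, translated bump tensor pointwise -/

/-- Coordinates of `y − a` for the chain's translation vector `a = −(A e₀ + S e₁)`. -/
theorem sub_cfgVec_apply_bc (y : E4) (A S : ℝ) :
    (y - -(A • EuclideanSpace.single 0 1 + S • EuclideanSpace.single 1 1) : E4) 0 = y 0 + A ∧
    (y - -(A • EuclideanSpace.single 0 1 + S • EuclideanSpace.single 1 1) : E4) 1 = y 1 + S ∧
    (y - -(A • EuclideanSpace.single 0 1 + S • EuclideanSpace.single 1 1) : E4) 2 = y 2 ∧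
    (y - -(A • EuclideanSpace.single 0 1 + S • EuclideanSpace.single 1 1) : E4) 3 = y 3 := by
  refine ⟨?_, ?_, ?_, ?_⟩ <;> simp

/-- **The configuration pointwise**: the radial-bump tensor rotated by `θ`, seen from `R_θ q` and pulled back by
`w e₀`, is the bump tensor with centres `R_θ c j − R_θ q − w e₀` (`rot_bump_apply`: a rotation moves the centres
and nothing else). -/
theorem cfg_apply_bc {n : ℕ} (φ : ℝ → ℂ) (hh : Fin n → ℝ × ℝ → ℂ) (c : Fin n → ℝ × ℝ)
    (T : 𝓢((Fin n → E4), ℂ))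
    (hT : ∀ x : Fin n → E4, T x = ∏ j, φ ((x j 0 - (c j).1) ^ 2 + (x j 1 - (c j).2) ^ 2) * hh j (x j 2, x j 3))
    (θ : ℝ) (q : ℝ × ℝ) (w : ℝ) (x : Fin n → E4) :
    translateMulti (-((Real.cos θ * q.1 + Real.sin θ * q.2 + w) • EuclideanSpace.single 0 1 +
          (-Real.sin θ * q.1 + Real.cos θ * q.2) • EuclideanSpace.single 1 1))
        (linActMulti (planeRot (0 : Fin 3) θ) T) x =
      ∏ j, φ ((x j 0 + (Real.cos θ * q.1 + Real.sin θ * q.2 + w) - (Real.cos θ * (c j).1 + Real.sin θ * (c j).2)) ^ 2 +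
          (x j 1 + (-Real.sin θ * q.1 + Real.cos θ * q.2) - (-Real.sin θ * (c j).1 + Real.cos θ * (c j).2)) ^ 2) *
        hh j (x j 2, x j 3) := by
  rw [translateMulti_apply, rot_bump_apply φ hh c T hT]
  refine Finset.prod_congr rfl fun j _ => ?_
  obtain ⟨e0, e1, e2, e3⟩ := sub_cfgVec_apply_bc (x j) (Real.cos θ * q.1 + Real.sin θ * q.2 + w)
    (-Real.sin θ * q.1 + Real.cos θ * q.2)
  rw [e0, e1, e2, e3]

/-! ## Conclusion (1): time-ordering of the configuration at real angles -/

/-- **Time-ordering of the rotated, pulled-back bump tensor.**  On the support slot `j` has time within `ρ` of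
`(R_θ c_j)₀ − (R_θ q)₀ − w`; the tube hypotheses at the real angle `θ` (`gap_pos_of_tube`) give
`(R_θ(c₀ − q))₀ > w + u + ρ` and `(R_θ(c_{i+1} − c_i))₀ > 2u + v`, so the times are positive and strictly
increasing. -/
theorem isTimeOrdered_cfg_bc {n : ℕ} {u v ρ w ε R : ℝ} (φ : ℝ → ℂ) (hh : Fin n → ℝ × ℝ → ℂ)
    (c : Fin n → ℝ × ℝ) (q : ℝ × ℝ) (T : 𝓢((Fin n → E4), ℂ))
    (hv : 0 < v) (hρ : 0 < ρ) (h2ρ : 2 * ρ ≤ u) (hR : 0 < R)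
    (hφ : ∀ s : ℝ, ρ ^ 2 < s → φ s = 0)
    (hT : ∀ x : Fin n → E4, T x = ∏ j, φ ((x j 0 - (c j).1) ^ 2 + (x j 1 - (c j).2) ^ 2) * hh j (x j 2, x j 3))
    (ht0 : ∀ j : Fin n, (j : ℕ) = 0 → ∀ ζ : ℂ, |ζ.re| < ε → |ζ.im| < R →
      |(-Complex.sin ζ * ((c j).1 - q.1) + Complex.cos ζ * ((c j).2 - q.2)).im| <
        (Complex.cos ζ * ((c j).1 - q.1) + Complex.sin ζ * ((c j).2 - q.2)).re - (w + u + ρ))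
    (htS : ∀ i j : Fin n, (j : ℕ) = i + 1 → ∀ ζ : ℂ, |ζ.re| < ε → |ζ.im| < R →
      |(-Complex.sin ζ * ((c j).1 - (c i).1) + Complex.cos ζ * ((c j).2 - (c i).2)).im| <
        (Complex.cos ζ * ((c j).1 - (c i).1) + Complex.sin ζ * ((c j).2 - (c i).2)).re - (2 * u + v))
    {θ : ℝ} (hθ : |θ| < ε) :
    IsTimeOrdered (translateMulti
      (-((Real.cos θ * q.1 + Real.sin θ * q.2 + w) • EuclideanSpace.single 0 1 +
        (-Real.sin θ * q.1 + Real.cos θ * q.2) • EuclideanSpace.single 1 1))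
      (linActMulti (planeRot (0 : Fin 3) θ) T)) := by
  intro x hx
  have hb : ∀ j : Fin n, |x j 0 + (Real.cos θ * q.1 + Real.sin θ * q.2 + w) -
      (Real.cos θ * (c j).1 + Real.sin θ * (c j).2)| ≤ ρ := fun j =>
    closure_minimal (t := {y : Fin n → E4 | |y j 0 + (Real.cos θ * q.1 + Real.sin θ * q.2 + w) -
        (Real.cos θ * (c j).1 + Real.sin θ * (c j).2)| ≤ ρ}) (fun y hy => by
      rw [Function.mem_support, cfg_apply_bc φ hh c T hT] at hy
      have h1 := left_ne_zero_of_mul (Finset.prod_ne_zero_iff.1 hy j (Finset.mem_univ j))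
      have h2 : (y j 0 + (Real.cos θ * q.1 + Real.sin θ * q.2 + w) -
            (Real.cos θ * (c j).1 + Real.sin θ * (c j).2)) ^ 2 +
          (y j 1 + (-Real.sin θ * q.1 + Real.cos θ * q.2) - (-Real.sin θ * (c j).1 + Real.cos θ * (c j).2)) ^ 2 ≤
            ρ ^ 2 := not_lt.1 fun h' => h1 (hφ _ h')
      exact abs_le_of_sq_le_sq (by nlinarith [sq_nonneg (y j 1 + (-Real.sin θ * q.1 + Real.cos θ * q.2) -
        (-Real.sin θ * (c j).1 + Real.cos θ * (c j).2))]) hρ.le)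
      (isClosed_le (by fun_prop) continuous_const) hx
  have hg0 : ∀ j : Fin n, (j : ℕ) = 0 →
      w + u + ρ < Real.cos θ * ((c j).1 - q.1) + Real.sin θ * ((c j).2 - q.2) := fun j hj =>
    gap_pos_of_tube hR (fun ζ h1 h2 => by exact_mod_cast ht0 j hj ζ h1 h2) hθ
  have hgS : ∀ i j : Fin n, (j : ℕ) = i + 1 →
      2 * u + v < Real.cos θ * ((c j).1 - (c i).1) + Real.sin θ * ((c j).2 - (c i).2) := fun i j hij =>
    gap_pos_of_tube hR (fun ζ h1 h2 => by exact_mod_cast htS i j hij ζ h1 h2) hθ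
  cases n with
  | zero => exact ⟨fun i => i.elim0, fun i => i.elim0⟩
  | succ k =>
    have hmono : StrictMono fun i => x i 0 := by
      refine Fin.strictMono_iff_lt_succ.2 fun i => ?_
      have h1 := (abs_le.1 (hb i.castSucc)).2
      have h2 := (abs_le.1 (hb i.succ)).1
      have h3 := hgS i.castSucc i.succ (by simp)
      dsimp only
      linarith
    have h0 : 0 < x 0 0 := by
      have h2 := (abs_le.1 (hb 0)).1
      have h3 := hg0 0 (by simp)
      linarith
    exact ⟨fun i => h0.trans_le (hmono.monotone (Fin.zero_le i)), hmono⟩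

/-! ## Conclusion (2): the chain, by induction on the degree -/

variable {S₁ : SchwingerFamily E4}

/-- **The chain of a radial-bump tensor** (induction on the degree; the insertion hypothesis is stated for a
general degree `m = n − 1 − j` so that it restricts to the tail `j ↦ j.succ` without casts).  Degree `0`: the
configuration is the empty test function `1`, `V ≡ Ψ_1`.  Degree `n + 1`: the tail tensor (`exists_bumpTensor_asm`)
seen from `c 0` with pull-back `u + v − ρ` has a chain `V'` by induction; the landed link `stub_bumpChainLink`
prepends item `0`. -/
theorem chain_exists_bc (h : OSReconstructionNoE1 S₁.toLabelled) (N : ℂ × ℂ → (h.Hilbert →L[ℂ] h.Hilbert))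
    (hN1 : ∀ p : ℂ × ℂ, |p.2.im| < p.1.re → ‖N p‖ ≤ 1)
    (hN2 : ∀ ψ ψ' : h.Hilbert, DifferentiableOn ℂ (fun p : ℂ × ℂ => ⟪ψ, N p ψ'⟫_ℂ)
      {p : ℂ × ℂ | |p.2.im| < p.1.re})
    (hN3 : ∀ (t b : ℝ), 0 < t → ∀ ψ : h.Hilbert,
      N ((t : ℂ), (b : ℂ)) ψ = h.transfer t (h.translate (b • EuclideanSpace.single 1 1) ψ))
    {u v ρ ε R : ℝ} (φ : ℝ → ℂ) (hu : 0 < u) (hv : 0 < v) (hρ : 0 < ρ) (h2ρ : 2 * ρ ≤ u) (hR : 0 < R)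
    (hφ : ∀ s : ℝ, ρ ^ 2 < s → φ s = 0) (n : ℕ) :
    ∀ (hh : Fin n → ℝ × ℝ → ℂ) (f : Fin n → 𝓢((Fin 1 → E4), ℂ)) (B : Fin n → (h.Hilbert →L[ℂ] h.Hilbert))
      (c : Fin n → ℝ × ℝ) (q : ℝ × ℝ) (w : ℝ) (T : 𝓢((Fin n → E4), ℂ)), 0 ≤ w →
      (∀ (j : Fin n) (x : Fin 1 → E4), f j x = φ ((x 0 0 - (u + ρ)) ^ 2 + (x 0 1) ^ 2) * hh j (x 0 2, x 0 3)) →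
      (∀ x : Fin n → E4, T x = ∏ j, φ ((x j 0 - (c j).1) ^ 2 + (x j 1 - (c j).2) ^ 2) * hh j (x j 2, x j 3)) →
      (∀ (j : Fin n) (m : ℕ), m = n - 1 - j → ∀ (W : 𝓢((Fin m → E4), ℂ)) (hW : IsTimeOrdered W)
        (hFW : IsTimeOrdered (SchwartzMap.appendTensor (f j)
          (translateMulti ((2 * u + v) • EuclideanSpace.single 0 1) W))),
        B j (h.fieldVec m (fun _ => ()) W hW) =
          h.fieldVec (1 + m) (fun _ => ()) (SchwartzMap.appendTensor (f j)
            (translateMulti ((2 * u + v) • EuclideanSpace.single 0 1) W)) hFW) →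
      (∀ j : Fin n, (j : ℕ) = 0 → ∀ ζ : ℂ, |ζ.re| < ε → |ζ.im| < R →
        |(-Complex.sin ζ * ((c j).1 - q.1) + Complex.cos ζ * ((c j).2 - q.2)).im| <
          (Complex.cos ζ * ((c j).1 - q.1) + Complex.sin ζ * ((c j).2 - q.2)).re - (w + u + ρ)) →
      (∀ i j : Fin n, (j : ℕ) = i + 1 → ∀ ζ : ℂ, |ζ.re| < ε → |ζ.im| < R →
        |(-Complex.sin ζ * ((c j).1 - (c i).1) + Complex.cos ζ * ((c j).2 - (c i).2)).im| <
          (Complex.cos ζ * ((c j).1 - (c i).1) + Complex.sin ζ * ((c j).2 - (c i).2)).re - (2 * u + v)) →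
      ∃ V : ℂ → h.Hilbert,
        DifferentiableOn ℂ V {ζ : ℂ | |ζ.re| < ε ∧ |ζ.im| < R} ∧
        (∀ ζ : ℂ, |ζ.re| < ε → |ζ.im| < R →
          ‖V ζ‖ ≤ (∏ j, ‖B j‖) * ‖h.fieldVec 0 (fun _ => ()) (SchwartzMap.constOfSubsingleton 1)
            OSReconstructionNoE1.isTimeOrdered_constOfSubsingleton‖) ∧
        (∀ θ : ℝ, |θ| < ε → ∀ hθ : IsTimeOrdered (translateMulti
              (-((Real.cos θ * q.1 + Real.sin θ * q.2 + w) • EuclideanSpace.single 0 1 +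
                (-Real.sin θ * q.1 + Real.cos θ * q.2) • EuclideanSpace.single 1 1))
              (linActMulti (planeRot (0 : Fin 3) θ) T)),
          V θ = h.fieldVec n (fun _ => ()) (translateMulti
              (-((Real.cos θ * q.1 + Real.sin θ * q.2 + w) • EuclideanSpace.single 0 1 +
                (-Real.sin θ * q.1 + Real.cos θ * q.2) • EuclideanSpace.single 1 1))
              (linActMulti (planeRot (0 : Fin 3) θ) T)) hθ) := by
  induction n with
  | zero =>
    intro hh f B c q w T _hw _hf hT _hB _ht0 _htS
    refine ⟨fun _ => h.fieldVec 0 (fun _ => ()) (SchwartzMap.constOfSubsingleton 1)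
      OSReconstructionNoE1.isTimeOrdered_constOfSubsingleton, differentiableOn_const _,
      fun ζ _ _ => by simp, fun θ _hθ hθ' => ?_⟩
    exact fieldVec_congr_cast h rfl _ hθ' fun x => by
      rw [cfg_apply_bc φ hh c T hT]
      simp
  | succ n ih =>
    intro hh f B c q w T hw hf hT hB ht0 htS
    -- the tail tensor as a Schwartz map
    have hf0 : ∀ (i : Fin n) (x : Fin 1 → E4),
        translateMulti (-((u + ρ) • EuclideanSpace.single 0 1)) (f i.succ) x =
          φ ((x 0 0) ^ 2 + (x 0 1) ^ 2) * hh i.succ (x 0 2, x 0 3) := by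
      intro i x
      rw [translateMulti_apply, hf]
      simp
    obtain ⟨T', hT'⟩ := exists_bumpTensor_asm φ (fun i => hh i.succ)
      (fun i => translateMulti (-((u + ρ) • EuclideanSpace.single 0 1)) (f i.succ)) (fun i => c i.succ) hf0
    have hw' : 0 ≤ u + v - ρ := by linarith
    have hB' : ∀ (i : Fin n) (m : ℕ), m = n - 1 - i → ∀ (W : 𝓢((Fin m → E4), ℂ)) (hW : IsTimeOrdered W)
        (hFW : IsTimeOrdered (SchwartzMap.appendTensor (f i.succ)
          (translateMulti ((2 * u + v) • EuclideanSpace.single 0 1) W))),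
        B i.succ (h.fieldVec m (fun _ => ()) W hW) =
          h.fieldVec (1 + m) (fun _ => ()) (SchwartzMap.appendTensor (f i.succ)
            (translateMulti ((2 * u + v) • EuclideanSpace.single 0 1) W)) hFW :=
      fun i m hm => hB i.succ m (by rw [Fin.val_succ]; omega)
    have ht0' : ∀ j : Fin n, (j : ℕ) = 0 → ∀ ζ : ℂ, |ζ.re| < ε → |ζ.im| < R →
        |(-Complex.sin ζ * ((c j.succ).1 - (c 0).1) + Complex.cos ζ * ((c j.succ).2 - (c 0).2)).im| <
          (Complex.cos ζ * ((c j.succ).1 - (c 0).1) + Complex.sin ζ * ((c j.succ).2 - (c 0).2)).re -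
            (u + v - ρ + u + ρ) := by
      intro j hj ζ h1 h2
      have e : u + v - ρ + u + ρ = 2 * u + v := by ring
      rw [e]
      exact htS 0 j.succ (by simp [hj]) ζ h1 h2
    have htS' : ∀ i j : Fin n, (j : ℕ) = i + 1 → ∀ ζ : ℂ, |ζ.re| < ε → |ζ.im| < R →
        |(-Complex.sin ζ * ((c j.succ).1 - (c i.succ).1) + Complex.cos ζ * ((c j.succ).2 - (c i.succ).2)).im| <
          (Complex.cos ζ * ((c j.succ).1 - (c i.succ).1) +
            Complex.sin ζ * ((c j.succ).2 - (c i.succ).2)).re - (2 * u + v) :=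
      fun i j hij => htS i.succ j.succ (by simp only [Fin.val_succ]; omega)
    obtain ⟨V', hV'd, hV'b, hV'r⟩ := ih (fun i => hh i.succ) (fun i => f i.succ) (fun i => B i.succ)
      (fun i => c i.succ) (c 0) (u + v - ρ) T' hw' (fun i => hf i.succ) hT' hB' ht0' htS'
    have hTO' := fun (θ : ℝ) (hθ : |θ| < ε) =>
      isTimeOrdered_cfg_bc φ (fun i => hh i.succ) (fun i => c i.succ) (c 0) T' hv hρ h2ρ hR hφ hT' ht0' htS' hθ
    -- the link
    obtain ⟨hD, hbd, hreal⟩ := stub_bumpChainLink S₁ h N hN1 hN2 hN3 n u v ρ w ε R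
      ((∏ i : Fin n, ‖B i.succ‖) * ‖h.fieldVec 0 (fun _ => ()) (SchwartzMap.constOfSubsingleton 1)
        OSReconstructionNoE1.isTimeOrdered_constOfSubsingleton‖)
      φ (hh 0) (f 0) (B 0) T' (c 0) q V' hu hv hρ h2ρ hw hR hφ (hf 0) (hB 0 n (by simp)) hV'd hV'b
      (fun θ hθ => ⟨hTO' θ hθ, hV'r θ hθ _⟩) (ht0 0 (by simp))
    refine ⟨_, hD, fun ζ h1 h2 => (hbd ζ h1 h2).trans_eq ?_, fun θ hθ hθ' => hreal θ hθ _ (fun x => ?_) hθ'⟩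
    · rw [Fin.prod_univ_succ]
      ring
    · rw [cfg_apply_bc φ hh c T hT, cfg_apply_bc φ (fun i => hh i.succ) (fun i => c i.succ) T' hT',
        Fin.prod_univ_succ]
      rfl

/-! ## The stub -/

/-- **Stub (T3, part B) — THE CHAIN OF A RADIAL-BUMP TENSOR** (model-blind OS bookkeeping over the
`e₀`-reconstruction).  Iterating the landed link `stub_bumpChainLink` along a radial-bump tensor `T` of degree `n`
(common radial profile `φ`, centres `c j`, transverse profiles `hh j`, insertion operators `B j`, previous points
`p j` and reserves `r j`): when every consecutive complex-rotated gap stays in the planar tube on the rectangle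
`{|Re ζ| < ε, |Im ζ| < R}`, the configuration `τ_{−(R_θ q + w e₀)} R_θ T` is time-ordered for real `|θ| < ε`
(`isTimeOrdered_cfg_bc`) and there is a family `V` holomorphic on the rectangle, bounded by `(∏ ‖B j‖)·‖Ψ_1‖`, with
these field vectors as real values (`chain_exists_bc`, induction on `n`). -/
theorem stub_bumpChain :
    open Literature.MathematicalPhysics.QuantumLattice Literature.MathematicalPhysics.AQFT
      Literature.MathematicalPhysics.QuantumFieldTheory
      Summit.QuantumFields.YangMills.Theorems.CurvatureBoostCovariance.Negative
      Summit.QuantumFields.YangMills.Theorems.NPointIsotropy.Negative in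
    (∀ (S₁ : SchwingerFamily E4) (h : OSReconstructionNoE1 S₁.toLabelled)
      (N : ℂ × ℂ → (h.Hilbert →L[ℂ] h.Hilbert)),
      (∀ p : ℂ × ℂ, |p.2.im| < p.1.re → ‖N p‖ ≤ 1) →
      (∀ ψ ψ' : h.Hilbert, DifferentiableOn ℂ (fun p : ℂ × ℂ => ⟪ψ, N p ψ'⟫_ℂ) {p : ℂ × ℂ | |p.2.im| < p.1.re}) →
      (∀ (t b : ℝ), 0 < t → ∀ ψ : h.Hilbert,
        N ((t : ℂ), (b : ℂ)) ψ = h.transfer t (h.translate (b • EuclideanSpace.single 1 1) ψ)) →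
      ∀ (n : ℕ) (u v ρ w ε R : ℝ) (φ : ℝ → ℂ) (hh : Fin n → ℝ × ℝ → ℂ) (f : Fin n → SchwartzMap (Fin 1 → E4) ℂ)
        (B : Fin n → (h.Hilbert →L[ℂ] h.Hilbert)) (c p : Fin n → ℝ × ℝ) (r : Fin n → ℝ) (q : ℝ × ℝ)
        (T : SchwartzMap (Fin n → E4) ℂ),
        0 < u → 0 < v → 0 < ρ → 2 * ρ ≤ u → 0 ≤ w → 0 < ε → 0 < R →
        (∀ s : ℝ, ρ ^ 2 < s → φ s = 0) →
        (∀ (j : Fin n) (x : Fin 1 → E4), f j x = φ ((x 0 0 - (u + ρ)) ^ 2 + (x 0 1) ^ 2) * hh j (x 0 2, x 0 3)) →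
        (∀ x : Fin n → E4, T x = ∏ j, φ ((x j 0 - (c j).1) ^ 2 + (x j 1 - (c j).2) ^ 2) * hh j (x j 2, x j 3)) →
        (∀ (j : Fin n) (W : SchwartzMap (Fin (n - 1 - j) → E4) ℂ) (hW : IsTimeOrdered W)
          (hFW : IsTimeOrdered (SchwartzMap.appendTensor (f j)
            (translateMulti ((2 * u + v) • EuclideanSpace.single 0 1) W))),
          B j (h.fieldVec (n - 1 - j) (fun _ => ()) W hW) =
            h.fieldVec (1 + (n - 1 - j)) (fun _ => ()) (SchwartzMap.appendTensor (f j)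
              (translateMulti ((2 * u + v) • EuclideanSpace.single 0 1) W)) hFW) →
        (∀ j : Fin n, (j : ℕ) = 0 → p j = q ∧ r j = w + u + ρ) →
        (∀ i j : Fin n, (j : ℕ) = i + 1 → p j = c i ∧ r j = 2 * u + v) →
        (∀ (j : Fin n) (ζ : ℂ), |ζ.re| < ε → |ζ.im| < R →
          |(-Complex.sin ζ * ((c j).1 - (p j).1) + Complex.cos ζ * ((c j).2 - (p j).2)).im| <
            (Complex.cos ζ * ((c j).1 - (p j).1) + Complex.sin ζ * ((c j).2 - (p j).2)).re - r j) →
        (∀ θ : ℝ, |θ| < ε → IsTimeOrdered (translateMulti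
              (-((Real.cos θ * q.1 + Real.sin θ * q.2 + w) • EuclideanSpace.single 0 1 +
                (-Real.sin θ * q.1 + Real.cos θ * q.2) • EuclideanSpace.single 1 1))
              (linActMulti (planeRot (0 : Fin 3) θ) T))) ∧
        ∃ V : ℂ → h.Hilbert,
          DifferentiableOn ℂ V {ζ : ℂ | |ζ.re| < ε ∧ |ζ.im| < R} ∧
          (∀ ζ : ℂ, |ζ.re| < ε → |ζ.im| < R →
            ‖V ζ‖ ≤ (∏ j, ‖B j‖) * ‖h.fieldVec 0 (fun _ => ()) (SchwartzMap.constOfSubsingleton 1)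
              OSReconstructionNoE1.isTimeOrdered_constOfSubsingleton‖) ∧
          (∀ θ : ℝ, |θ| < ε → ∀ hθ : IsTimeOrdered (translateMulti
                  (-((Real.cos θ * q.1 + Real.sin θ * q.2 + w) • EuclideanSpace.single 0 1 +
                    (-Real.sin θ * q.1 + Real.cos θ * q.2) • EuclideanSpace.single 1 1))
                  (linActMulti (planeRot (0 : Fin 3) θ) T)),
            V θ = h.fieldVec n (fun _ => ()) (translateMulti
                  (-((Real.cos θ * q.1 + Real.sin θ * q.2 + w) • EuclideanSpace.single 0 1 +
                    (-Real.sin θ * q.1 + Real.cos θ * q.2) • EuclideanSpace.single 1 1))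
                  (linActMulti (planeRot (0 : Fin 3) θ) T)) hθ)) := by
  intro S₁ h N hN1 hN2 hN3 n u v ρ w ε R φ hh f B c p r q T hu hv hρ h2ρ hw _hε hR hφ hf hT hB hp0 hpS htube
  have ht0 : ∀ j : Fin n, (j : ℕ) = 0 → ∀ ζ : ℂ, |ζ.re| < ε → |ζ.im| < R →
      |(-Complex.sin ζ * ((c j).1 - q.1) + Complex.cos ζ * ((c j).2 - q.2)).im| <
        (Complex.cos ζ * ((c j).1 - q.1) + Complex.sin ζ * ((c j).2 - q.2)).re - (w + u + ρ) := by
    intro j hj ζ h1 h2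
    obtain ⟨hpj, hrj⟩ := hp0 j hj
    have h3 := htube j ζ h1 h2
    rw [hpj, hrj] at h3
    exact h3
  have htS : ∀ i j : Fin n, (j : ℕ) = i + 1 → ∀ ζ : ℂ, |ζ.re| < ε → |ζ.im| < R →
      |(-Complex.sin ζ * ((c j).1 - (c i).1) + Complex.cos ζ * ((c j).2 - (c i).2)).im| <
        (Complex.cos ζ * ((c j).1 - (c i).1) + Complex.sin ζ * ((c j).2 - (c i).2)).re - (2 * u + v) := by
    intro i j hij ζ h1 h2
    obtain ⟨hpj, hrj⟩ := hpS i j hij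
    have h3 := htube j ζ h1 h2
    rw [hpj, hrj] at h3
    exact h3
  exact ⟨fun θ hθ => isTimeOrdered_cfg_bc φ hh c q T hv hρ h2ρ hR hφ hT ht0 htS hθ,
    chain_exists_bc h N hN1 hN2 hN3 φ hu hv hρ h2ρ hR hφ n hh f B c q w T hw hf hT
      (fun j m hm W hW hFW => by subst hm; exact hB j W hW hFW) ht0 htS⟩

end Summit.QuantumFields.YangMills.Theorems.SoftKernelBoostCovariance.Sketch

end
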